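import Mathlib.Data.ZMod.Basic
import Mathlib.Analysis.SpecialFunctions.Pow.Real
import Mathlib.Analysis.SpecialFunctions.Sqrt
import Mathlib.NumberTheory.Harmonic.Bounds
import Mathlib.Algebra.Order.BigOperators.Ring.Finset
import Mathlib.Analysis.Complex.Basic
import HarnessLib

/-!
# Route `PrimeLevelFamEdge`, crux K_B (stmt-Parity-20343), line `diagonal_kernel_split` rev 4, plan Ω,
# node L7b (OMEGA-BLUEPRINT v4 §3c) `OffDiagFlatness`, part 1 of 2: **one variable in residue classes —
# the `ℓ²`-mass `Σ_{ρ mod h} (Σ_{β ≤ B, β ≡ ρ} v β)²` is `≤ κ²(1 + log B + 8B/h)` under `0 ≤ v ≤ κ β^{-1/2}`,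
# `≤ κ²B(1 + 2B/h)` under `0 ≤ v ≤ κ`**

After the divisor switch and the level split (`OffDiagLevelAP`: `levelAPSum = levelPrincipal + levelDeviation`) the
large-conductor part a8R of the dual core is `Σ_h Σ_{c ∈ (ℤ/h)ˣ} W(h,c)·L_R(h,c)` with `L_R` the part of the level
sum in the class `c` carried by conductors `> R` and `W(h,c)` the total weight `c_l c_m Φ̂_…` of the sources
`σ = (r, l, m, d₁, d₂, i, s, …)` whose class `−(l/d₁)(m/d₂)((r+1)s)⁻¹ mod h` is `c`. Node L7a
(`Literature.NumberTheory.Sieve.LargeSieve.sum_units_norm_sq_largePart_eq`, `sum_totient_inv_largeConductor_le'`)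
bounds it by `‖W‖₂·(1 + log Q)(2(N+1)/R + 4Q)^{1/2}‖a‖₂` (Cauchy–Schwarz + Parseval + large sieve). Node L7b is
the arithmetic of `‖W‖₂`: FLATNESS — one variable `β` of a source runs through an interval `[1, B]` and its class
is an injective image of `β mod h`, so at most `B/h + 1` sources of a ladder share a class and `Σ_c W(h,c)²` is the
flat size `‖W(h,·)‖₁²/h` up to an absolute factor and the diagonal ("small-`lm` spike") term. This file: the
one-variable count; part 2 (`OffDiagFlatnessAggregate`) aggregates over the outer indices by Minkowski in `ℓ²`.

* §1 `sum_Icc_rpow_neg_half_le` (`Σ_{j≤J} j^{-1/2} ≤ 2√J`), `sum_Icc_inv_le_one_add_log` (`Σ_{β≤B} β⁻¹ ≤ 1 + log B`),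
  `sq_mul_rpow_neg_half`.
* §2 modulo `h ≥ 1`: `filter_gt_modEq_subset_image` (the class-mates `β' > β` of `β` in `[1,B]` lie on the ladder
  `β + jh`, `1 ≤ j ≤ B/h`), `sum_filter_gt_modEq_le_of_le_rpow` (they weigh `≤ κ·2√B/h` under
  `0 ≤ v ≤ κβ^{-1/2}`) / `sum_filter_gt_modEq_le_of_le_const` (`≤ κ·B/h` under `0 ≤ v ≤ κ`), the exact identity
  `sum_sq_classSum_eq` (`Σ_ρ (Σ_{β≡ρ} v)² = Σ_β v_β² + 2Σ_β v_β Σ_{β'>β, β'≡β} v_{β'}`), and the flatness bounds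
  **`sum_sq_classSum_le_of_le_rpow`** (`≤ κ²(1 + log B + 8B/h)`; flat size `4κ²B/h`) and
  `sum_sq_classSum_le_of_le_const` (`≤ κ²B(1 + 2B/h)`; flat size `κ²B²/h`).
Pure finite inequalities, no definition; helper toward `stub_offDiagBelowSlack_io` (`--supports stmt-Parity-20343`);
closes nothing; standard axioms.
«The programme SEARCHES and TYPES; no claim about Landau–Siegel zeros, Theorems 1–2 of arXiv:2211.02515 or
a repaired Margin232 until a kernel theorem says so.»
-/

noncomputable section

namespace Summit.Parity.GeneralizedHardyLittlewood.Theorems.BeyondDiagonalBeatsQuarter.OffDiag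

open Finset Real

/-! ### §1. Two elementary sums -/

/-- `Σ_{j=1}^{J} j^{-1/2} ≤ 2√J`. [folklore] -/
theorem sum_Icc_rpow_neg_half_le (J : ℕ) :
    ∑ j ∈ Icc 1 J, ((j : ℝ)) ^ (-(1 / 2 : ℝ)) ≤ 2 * Real.sqrt J := by
  induction J with
  | zero => simp
  | succ J ih =>
    rw [Finset.sum_Icc_succ_top (by omega)]
    have hJ0 : (0 : ℝ) ≤ J := Nat.cast_nonneg J
    have hJ1 : (0 : ℝ) < (J : ℝ) + 1 := by linarith
    have hrpow : (((J + 1 : ℕ) : ℝ)) ^ (-(1 / 2 : ℝ)) = (Real.sqrt ((J : ℝ) + 1))⁻¹ := by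
      push_cast
      rw [Real.rpow_neg hJ1.le, ← Real.sqrt_eq_rpow]
    rw [hrpow]
    push_cast
    set s := Real.sqrt ((J : ℝ) + 1) with hs
    set t := Real.sqrt (J : ℝ) with ht
    have hs0 : 0 < s := Real.sqrt_pos.2 hJ1
    have ht0 : 0 ≤ t := Real.sqrt_nonneg _
    have hss : s * s = (J : ℝ) + 1 := Real.mul_self_sqrt hJ1.le
    have htt : t * t = (J : ℝ) := Real.mul_self_sqrt hJ0
    have hts : t ≤ s := Real.sqrt_le_sqrt (by linarith)
    -- `2t + 1/s ≤ 2s` ⟸ `2ts + 1 ≤ 2s²` ⟸ `(s − t)² ≥ 0`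
    have key : 2 * t + s⁻¹ ≤ 2 * s := by
      rw [← sub_nonneg]
      have : 2 * s - (2 * t + s⁻¹) = (2 * (s * s) - 2 * (t * s) - 1) / s := by
        field_simp
        ring
      rw [this]
      apply div_nonneg _ hs0.le
      nlinarith [sq_nonneg (s - t)]
    linarith

/-- `Σ_{β=1}^{B} β⁻¹ ≤ 1 + log B` (Mathlib's `harmonic_le_one_add_log`). [folklore] -/
theorem sum_Icc_inv_le_one_add_log (B : ℕ) :
    ∑ β ∈ Icc 1 B, ((β : ℝ))⁻¹ ≤ 1 + Real.log B := by
  have h := harmonic_le_one_add_log B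
  simpa [harmonic_eq_sum_Icc, Rat.cast_sum, Rat.cast_inv, Rat.cast_natCast] using h

/-- `Σ_{β=1}^{B} β^{-1/2}·… `: the square of the majorant, `(κ β^{-1/2})² = κ² β⁻¹` for `β ≥ 1`. [folklore] -/
theorem sq_mul_rpow_neg_half {β : ℕ} (hβ : 1 ≤ β) (κ : ℝ) :
    (κ * ((β : ℝ)) ^ (-(1 / 2 : ℝ))) ^ 2 = κ ^ 2 * ((β : ℝ))⁻¹ := by
  have hβ0 : (0 : ℝ) < β := by exact_mod_cast hβ
  have hx : (((β : ℝ)) ^ (-(1 / 2 : ℝ))) ^ 2 = ((β : ℝ))⁻¹ := by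
    rw [← Real.rpow_two, ← Real.rpow_mul hβ0.le]
    norm_num
    exact Real.rpow_neg_one _
  rw [mul_pow, hx]

/-! ### §2. One variable in residue classes modulo `h ≥ 1` -/

section OneVariable

variable {h : ℕ}

/-- The class-mates above `β` lie on the ladder `β + h, β + 2h, …`:
`{β' ∈ [1,B] : β < β', β' ≡ β (mod h)} ⊆ {β + j h : 1 ≤ j ≤ B / h}` (`h ≥ 1`). [folklore] -/
theorem filter_gt_modEq_subset_image (hh : 0 < h) (B β : ℕ) :
    (Icc 1 B).filter (fun β' : ℕ => β < β' ∧ (β' : ZMod h) = (β : ZMod h)) ⊆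
      (Icc 1 (B / h)).image (fun j : ℕ => β + j * h) := by
  intro β' hβ'
  simp only [Finset.mem_filter, Finset.mem_Icc] at hβ'
  obtain ⟨⟨-, hB⟩, hlt, hmod⟩ := hβ'
  rw [ZMod.natCast_eq_natCast_iff] at hmod
  obtain ⟨j, hj⟩ := (Nat.modEq_iff_dvd' hlt.le).1 hmod.symm
  simp only [Finset.mem_image, Finset.mem_Icc]
  refine ⟨j, ⟨?_, ?_⟩, ?_⟩
  · rcases Nat.eq_zero_or_pos j with hj0 | hj0
    · exfalso
      rw [hj0, mul_zero] at hj
      omega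
    · exact hj0
  · rw [Nat.le_div_iff_mul_le hh]
    calc j * h = h * j := mul_comm _ _
      _ = β' - β := hj.symm
      _ ≤ B := by omega
  · rw [mul_comm]
    omega

/-- **Upper class-mates under the majorant `κ β^{-1/2}`.** For `h ≥ 1` and `0 ≤ v ≤ κ β^{-1/2}` on `[1,B]`:
`Σ_{β' ∈ [1,B], β' > β, β' ≡ β (mod h)} v(β') ≤ κ · 2√B / h`
(the `j`-th class-mate is `≥ j h`, and `Σ_{j ≤ B/h} (jh)^{-1/2} ≤ h^{-1/2}·2√(B/h)`). [folklore] -/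
theorem sum_filter_gt_modEq_le_of_le_rpow (hh : 0 < h) {B : ℕ} {κ : ℝ} {v : ℕ → ℝ}
    (hv : ∀ β ∈ Icc 1 B, 0 ≤ v β ∧ v β ≤ κ * ((β : ℝ)) ^ (-(1 / 2 : ℝ))) (β : ℕ) :
    ∑ β' ∈ (Icc 1 B).filter (fun β' : ℕ => β < β' ∧ (β' : ZMod h) = (β : ZMod h)), v β' ≤
      κ * (2 * Real.sqrt B / h) := by
  rcases Nat.eq_zero_or_pos B with hB0 | hB0
  · subst hB0
    simp
  have hκ : 0 ≤ κ := by
    have h1 := hv 1 (Finset.mem_Icc.2 ⟨le_rfl, by omega⟩)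
    simp only [Nat.cast_one, Real.one_rpow, mul_one] at h1
    exact h1.1.trans h1.2
  have hh0 : (0 : ℝ) < h := by exact_mod_cast hh
  set S := (Icc 1 B).filter (fun β' : ℕ => β < β' ∧ (β' : ZMod h) = (β : ZMod h)) with hS
  have hSsub : S ⊆ Icc 1 B := Finset.filter_subset _ _
  calc ∑ β' ∈ S, v β' ≤ ∑ β' ∈ S, κ * ((β' : ℝ)) ^ (-(1 / 2 : ℝ)) :=
        Finset.sum_le_sum fun β' hβ' => (hv β' (hSsub hβ')).2
    _ ≤ ∑ β' ∈ (Icc 1 (B / h)).image (fun j : ℕ => β + j * h), κ * ((β' : ℝ)) ^ (-(1 / 2 : ℝ)) :=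
        Finset.sum_le_sum_of_subset_of_nonneg (filter_gt_modEq_subset_image hh B β)
          fun β' _ _ => mul_nonneg hκ (Real.rpow_nonneg (Nat.cast_nonneg _) _)
    _ = ∑ j ∈ Icc 1 (B / h), κ * (((β + j * h : ℕ) : ℝ)) ^ (-(1 / 2 : ℝ)) := by
        rw [Finset.sum_image]
        intro j _ j' _ hjj
        have hjj' : β + j * h = β + j' * h := hjj
        have : j * h = j' * h := by omega
        exact Nat.eq_of_mul_eq_mul_right hh this
    _ ≤ ∑ j ∈ Icc 1 (B / h), κ * (((h : ℝ)) ^ (-(1 / 2 : ℝ)) * ((j : ℝ)) ^ (-(1 / 2 : ℝ))) := by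
        refine Finset.sum_le_sum fun j hj => mul_le_mul_of_nonneg_left ?_ hκ
        have hj1 : 1 ≤ j := (Finset.mem_Icc.1 hj).1
        have hjh0 : (0 : ℝ) < (j : ℝ) * h := by positivity
        rw [← Real.mul_rpow hh0.le (Nat.cast_nonneg j), mul_comm ((h : ℝ))]
        refine Real.rpow_le_rpow_of_nonpos hjh0 ?_ (by norm_num)
        push_cast
        nlinarith
    _ = κ * ((h : ℝ)) ^ (-(1 / 2 : ℝ)) * ∑ j ∈ Icc 1 (B / h), ((j : ℝ)) ^ (-(1 / 2 : ℝ)) := by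
        rw [Finset.mul_sum]
        exact Finset.sum_congr rfl fun j _ => by ring
    _ ≤ κ * ((h : ℝ)) ^ (-(1 / 2 : ℝ)) * (2 * Real.sqrt ((B : ℝ) / h)) := by
        refine mul_le_mul_of_nonneg_left ?_ (mul_nonneg hκ (Real.rpow_nonneg hh0.le _))
        refine (sum_Icc_rpow_neg_half_le (B / h)).trans ?_
        exact mul_le_mul_of_nonneg_left (Real.sqrt_le_sqrt Nat.cast_div_le) (by norm_num)
    _ = κ * (2 * Real.sqrt B / h) := by
        have hsq : Real.sqrt (h : ℝ) ^ 2 = h := Real.sq_sqrt hh0.le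
        have hsh : 0 < Real.sqrt (h : ℝ) := Real.sqrt_pos.2 hh0
        rw [Real.rpow_neg hh0.le, ← Real.sqrt_eq_rpow, Real.sqrt_div (Nat.cast_nonneg B)]
        field_simp
        rw [hsq]

/-- **Upper class-mates under a constant majorant.** For `h ≥ 1` and `0 ≤ v ≤ κ` on `[1,B]`:
`Σ_{β' ∈ [1,B], β' > β, β' ≡ β (mod h)} v(β') ≤ κ · B / h` (at most `B/h` class-mates). [folklore] -/
theorem sum_filter_gt_modEq_le_of_le_const (hh : 0 < h) {B : ℕ} {κ : ℝ} {v : ℕ → ℝ}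
    (hv : ∀ β ∈ Icc 1 B, 0 ≤ v β ∧ v β ≤ κ) (β : ℕ) :
    ∑ β' ∈ (Icc 1 B).filter (fun β' : ℕ => β < β' ∧ (β' : ZMod h) = (β : ZMod h)), v β' ≤
      κ * ((B : ℝ) / h) := by
  rcases Nat.eq_zero_or_pos B with hB0 | hB0
  · subst hB0
    simp
  have hκ : 0 ≤ κ := by
    have h1 := hv 1 (Finset.mem_Icc.2 ⟨le_rfl, by omega⟩)
    exact h1.1.trans h1.2
  have hh0 : (0 : ℝ) < h := by exact_mod_cast hh
  set S := (Icc 1 B).filter (fun β' : ℕ => β < β' ∧ (β' : ZMod h) = (β : ZMod h)) with hS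
  have hSsub : S ⊆ Icc 1 B := Finset.filter_subset _ _
  have hcard : (S.card : ℝ) ≤ (B : ℝ) / h := by
    have h1 : S.card ≤ B / h :=
      (Finset.card_le_card (filter_gt_modEq_subset_image hh B β)).trans
        (Finset.card_image_le.trans (by simp))
    exact (Nat.cast_le.2 h1).trans Nat.cast_div_le
  calc ∑ β' ∈ S, v β' ≤ ∑ β' ∈ S, κ := Finset.sum_le_sum fun β' hβ' => (hv β' (hSsub hβ')).2
    _ = S.card * κ := by rw [Finset.sum_const, nsmul_eq_mul]
    _ ≤ (B : ℝ) / h * κ := mul_le_mul_of_nonneg_right hcard hκ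
    _ = κ * ((B : ℝ) / h) := mul_comm _ _

/-- **The `ℓ²`-mass of the class sums, exactly**: for `h ≥ 1` (so that `ZMod h` is finite) and any `v`,
`Σ_{ρ mod h} (Σ_{β ∈ [1,B], β ≡ ρ} v β)² = Σ_β v_β² + 2·Σ_β v_β·Σ_{β' > β, β' ≡ β} v_{β'}`
(expand the square, split the inner class by `β' < β`, `β' = β`, `β' > β`, and exchange the two off-diagonal sums).
[folklore] -/
theorem sum_sq_classSum_eq [NeZero h] (B : ℕ) (v : ℕ → ℝ) :
    ∑ ρ : ZMod h, (∑ β ∈ (Icc 1 B).filter (fun β : ℕ => (β : ZMod h) = ρ), v β) ^ 2 =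
      ∑ β ∈ Icc 1 B, v β ^ 2 +
        2 * ∑ β ∈ Icc 1 B, v β *
          ∑ β' ∈ (Icc 1 B).filter (fun β' : ℕ => β < β' ∧ (β' : ZMod h) = (β : ZMod h)), v β' := by
  classical
  set I := Icc 1 B with hI
  -- Step A: fibrewise, `Σ_ρ (Σ_{C_ρ} v)² = Σ_β v β · Σ_{β' ≡ β} v β'`
  have hA : ∑ ρ : ZMod h, (∑ β ∈ I.filter (fun β : ℕ => (β : ZMod h) = ρ), v β) ^ 2 =
      ∑ β ∈ I, v β * ∑ β' ∈ I.filter (fun β' : ℕ => (β' : ZMod h) = (β : ZMod h)), v β' := by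
    have hsq : ∀ ρ : ZMod h, (∑ β ∈ I.filter (fun β : ℕ => (β : ZMod h) = ρ), v β) ^ 2 =
        ∑ β ∈ I.filter (fun β : ℕ => (β : ZMod h) = ρ),
          v β * ∑ β' ∈ I.filter (fun β' : ℕ => (β' : ZMod h) = (β : ZMod h)), v β' := by
      intro ρ
      rw [sq, Finset.sum_mul]
      refine Finset.sum_congr rfl fun β hβ => ?_
      rw [(Finset.mem_filter.1 hβ).2]
    simp_rw [hsq]
    exact Finset.sum_fiberwise I (fun β : ℕ => (β : ZMod h)) _
  -- Step B: split the inner class sum at `β`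
  have hB : ∀ β ∈ I, ∑ β' ∈ I.filter (fun β' : ℕ => (β' : ZMod h) = (β : ZMod h)), v β' =
      ∑ β' ∈ I.filter (fun β' : ℕ => β' < β ∧ (β' : ZMod h) = (β : ZMod h)), v β' + v β +
        ∑ β' ∈ I.filter (fun β' : ℕ => β < β' ∧ (β' : ZMod h) = (β : ZMod h)), v β' := by
    intro β hβ
    have hmid : v β = ∑ β' ∈ I, if β' = β then v β' else 0 := by
      rw [Finset.sum_ite_eq' I β (fun β' => v β'), if_pos hβ]
    rw [Finset.sum_filter, Finset.sum_filter, Finset.sum_filter, hmid, ← Finset.sum_add_distrib,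
      ← Finset.sum_add_distrib]
    refine Finset.sum_congr rfl fun β' _ => ?_
    rcases lt_trichotomy β' β with hlt | heq | hgt
    · simp [hlt, hlt.ne, not_lt.2 hlt.le]
    · subst heq
      simp
    · simp [hgt, hgt.ne', not_lt.2 hgt.le]
  -- Step C: exchange the lower off-diagonal sum
  have hC : ∑ β ∈ I, v β * ∑ β' ∈ I.filter (fun β' : ℕ => β' < β ∧ (β' : ZMod h) = (β : ZMod h)), v β' =
      ∑ β' ∈ I, v β' * ∑ β ∈ I.filter (fun β : ℕ => β' < β ∧ (β : ZMod h) = (β' : ZMod h)), v β := by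
    simp_rw [Finset.mul_sum]
    rw [Finset.sum_comm' (t' := I)
      (s' := fun β' => I.filter (fun β : ℕ => β' < β ∧ (β : ZMod h) = (β' : ZMod h)))]
    · exact Finset.sum_congr rfl fun β' _ => Finset.sum_congr rfl fun β _ => mul_comm _ _
    · intro β β'
      simp only [Finset.mem_filter]
      constructor
      · rintro ⟨h1, h2, h3, h4⟩
        exact ⟨⟨h1, h3, h4.symm⟩, h2⟩
      · rintro ⟨⟨h1, h3, h4⟩, h2⟩
        exact ⟨h1, h2, h3, h4.symm⟩
  rw [hA, Finset.sum_congr rfl fun β hβ => by rw [hB β hβ]]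
  simp_rw [mul_add, Finset.sum_add_distrib]
  rw [hC]
  have hdiag : ∑ β ∈ I, v β * v β = ∑ β ∈ I, v β ^ 2 := Finset.sum_congr rfl fun β _ => by ring
  rw [hdiag]
  ring

/-- **Flatness, one variable, majorant `κ β^{-1/2}`.** For `h ≥ 1` and `0 ≤ v(β) ≤ κ β^{-1/2}` on `[1,B]`:
`Σ_{ρ mod h} (Σ_{β ∈ [1,B], β ≡ ρ (mod h)} v β)² ≤ κ²·(1 + log B + 8B/h)`
(diagonal `κ² Σ β⁻¹ ≤ κ²(1 + log B)`; off-diagonal `2·Σ_β v_β·κ·2√B/h ≤ 2·2κ√B·2κ√B/h`). The flat size is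
`(Σ_β v)²/h ≤ 4κ²B/h`: flat up to the factor `2` and the diagonal spike `κ²(1 + log B)`. [folklore] -/
theorem sum_sq_classSum_le_of_le_rpow [NeZero h] {B : ℕ} {κ : ℝ} {v : ℕ → ℝ}
    (hv : ∀ β ∈ Icc 1 B, 0 ≤ v β ∧ v β ≤ κ * ((β : ℝ)) ^ (-(1 / 2 : ℝ))) :
    ∑ ρ : ZMod h, (∑ β ∈ (Icc 1 B).filter (fun β : ℕ => (β : ZMod h) = ρ), v β) ^ 2 ≤
      κ ^ 2 * (1 + Real.log B + 8 * (B : ℝ) / h) := by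
  have hh : 0 < h := Nat.pos_of_ne_zero (NeZero.ne h)
  have hh0 : (0 : ℝ) < h := by exact_mod_cast hh
  rw [sum_sq_classSum_eq]
  -- diagonal
  have hdiag : ∑ β ∈ Icc 1 B, v β ^ 2 ≤ κ ^ 2 * (1 + Real.log B) := by
    calc ∑ β ∈ Icc 1 B, v β ^ 2 ≤ ∑ β ∈ Icc 1 B, κ ^ 2 * ((β : ℝ))⁻¹ := by
          refine Finset.sum_le_sum fun β hβ => ?_
          rw [← sq_mul_rpow_neg_half (Finset.mem_Icc.1 hβ).1 κ]
          exact pow_le_pow_left₀ (hv β hβ).1 (hv β hβ).2 2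
      _ = κ ^ 2 * ∑ β ∈ Icc 1 B, ((β : ℝ))⁻¹ := by rw [Finset.mul_sum]
      _ ≤ κ ^ 2 * (1 + Real.log B) :=
          mul_le_mul_of_nonneg_left (sum_Icc_inv_le_one_add_log B) (sq_nonneg κ)
  -- the `ℓ¹` mass
  have hmass : ∑ β ∈ Icc 1 B, v β ≤ κ * (2 * Real.sqrt B) := by
    calc ∑ β ∈ Icc 1 B, v β ≤ ∑ β ∈ Icc 1 B, κ * ((β : ℝ)) ^ (-(1 / 2 : ℝ)) :=
          Finset.sum_le_sum fun β hβ => (hv β hβ).2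
      _ = κ * ∑ β ∈ Icc 1 B, ((β : ℝ)) ^ (-(1 / 2 : ℝ)) := by rw [Finset.mul_sum]
      _ ≤ κ * (2 * Real.sqrt B) := by
          rcases Nat.eq_zero_or_pos B with hB0 | hB0
          · subst hB0; simp
          · have hκ : 0 ≤ κ := by
              have h1 := hv 1 (Finset.mem_Icc.2 ⟨le_rfl, by omega⟩)
              simp only [Nat.cast_one, Real.one_rpow, mul_one] at h1
              exact h1.1.trans h1.2
            exact mul_le_mul_of_nonneg_left (sum_Icc_rpow_neg_half_le B) hκ
  -- off-diagonal
  have hoff : ∑ β ∈ Icc 1 B, v β *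
      ∑ β' ∈ (Icc 1 B).filter (fun β' : ℕ => β < β' ∧ (β' : ZMod h) = (β : ZMod h)), v β' ≤
        κ ^ 2 * (4 * (B : ℝ) / h) := by
    rcases Nat.eq_zero_or_pos B with hB0 | hB0
    · subst hB0; simp
    have hκ : 0 ≤ κ := by
      have h1 := hv 1 (Finset.mem_Icc.2 ⟨le_rfl, by omega⟩)
      simp only [Nat.cast_one, Real.one_rpow, mul_one] at h1
      exact h1.1.trans h1.2
    have hc0 : 0 ≤ κ * (2 * Real.sqrt B / h) := by positivity
    calc ∑ β ∈ Icc 1 B, v β *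
          ∑ β' ∈ (Icc 1 B).filter (fun β' : ℕ => β < β' ∧ (β' : ZMod h) = (β : ZMod h)), v β'
        ≤ ∑ β ∈ Icc 1 B, v β * (κ * (2 * Real.sqrt B / h)) :=
          Finset.sum_le_sum fun β hβ =>
            mul_le_mul_of_nonneg_left (sum_filter_gt_modEq_le_of_le_rpow hh hv β) (hv β hβ).1
      _ = (∑ β ∈ Icc 1 B, v β) * (κ * (2 * Real.sqrt B / h)) := by rw [Finset.sum_mul]
      _ ≤ κ * (2 * Real.sqrt B) * (κ * (2 * Real.sqrt B / h)) := mul_le_mul_of_nonneg_right hmass hc0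
      _ = κ ^ 2 * (4 * (B : ℝ) / h) := by
          have hsq : Real.sqrt (B : ℝ) ^ 2 = B := Real.sq_sqrt (Nat.cast_nonneg B)
          rw [show κ * (2 * Real.sqrt B) * (κ * (2 * Real.sqrt B / h)) =
            κ ^ 2 * (4 * Real.sqrt (B : ℝ) ^ 2 / h) by ring, hsq]
  have htot : κ ^ 2 * (1 + Real.log B) + 2 * (κ ^ 2 * (4 * (B : ℝ) / h)) =
      κ ^ 2 * (1 + Real.log B + 8 * (B : ℝ) / h) := by ring
  linarith

/-- **Flatness, one variable, constant majorant.** For `h ≥ 1` and `0 ≤ v(β) ≤ κ` on `[1,B]`: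
`Σ_{ρ mod h} (Σ_{β ∈ [1,B], β ≡ ρ (mod h)} v β)² ≤ κ²·B·(1 + 2B/h)` (the count: each `β` has at most `B/h`
class-mates above it). The flat size is `κ²B²/h`. [folklore] -/
theorem sum_sq_classSum_le_of_le_const [NeZero h] {B : ℕ} {κ : ℝ} {v : ℕ → ℝ}
    (hv : ∀ β ∈ Icc 1 B, 0 ≤ v β ∧ v β ≤ κ) :
    ∑ ρ : ZMod h, (∑ β ∈ (Icc 1 B).filter (fun β : ℕ => (β : ZMod h) = ρ), v β) ^ 2 ≤
      κ ^ 2 * B * (1 + 2 * (B : ℝ) / h) := by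
  have hh : 0 < h := Nat.pos_of_ne_zero (NeZero.ne h)
  have hh0 : (0 : ℝ) < h := by exact_mod_cast hh
  rw [sum_sq_classSum_eq]
  rcases Nat.eq_zero_or_pos B with hB0 | hB0
  · subst hB0; simp
  have hκ : 0 ≤ κ := by
    have h1 := hv 1 (Finset.mem_Icc.2 ⟨le_rfl, by omega⟩)
    exact h1.1.trans h1.2
  have hdiag : ∑ β ∈ Icc 1 B, v β ^ 2 ≤ κ ^ 2 * B := by
    calc ∑ β ∈ Icc 1 B, v β ^ 2 ≤ ∑ β ∈ Icc 1 B, κ ^ 2 :=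
          Finset.sum_le_sum fun β hβ => pow_le_pow_left₀ (hv β hβ).1 (hv β hβ).2 2
      _ = κ ^ 2 * B := by rw [Finset.sum_const, Nat.card_Icc, nsmul_eq_mul]; push_cast; ring
  have hmass : ∑ β ∈ Icc 1 B, v β ≤ κ * B := by
    calc ∑ β ∈ Icc 1 B, v β ≤ ∑ β ∈ Icc 1 B, κ := Finset.sum_le_sum fun β hβ => (hv β hβ).2
      _ = κ * B := by rw [Finset.sum_const, Nat.card_Icc, nsmul_eq_mul]; push_cast; ring
  have hoff : ∑ β ∈ Icc 1 B, v β *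
      ∑ β' ∈ (Icc 1 B).filter (fun β' : ℕ => β < β' ∧ (β' : ZMod h) = (β : ZMod h)), v β' ≤
        κ * B * (κ * ((B : ℝ) / h)) := by
    have hc0 : 0 ≤ κ * ((B : ℝ) / h) := by positivity
    calc ∑ β ∈ Icc 1 B, v β *
          ∑ β' ∈ (Icc 1 B).filter (fun β' : ℕ => β < β' ∧ (β' : ZMod h) = (β : ZMod h)), v β'
        ≤ ∑ β ∈ Icc 1 B, v β * (κ * ((B : ℝ) / h)) :=
          Finset.sum_le_sum fun β hβ =>
            mul_le_mul_of_nonneg_left (sum_filter_gt_modEq_le_of_le_const hh hv β) (hv β hβ).1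
      _ = (∑ β ∈ Icc 1 B, v β) * (κ * ((B : ℝ) / h)) := by rw [Finset.sum_mul]
      _ ≤ κ * B * (κ * ((B : ℝ) / h)) := mul_le_mul_of_nonneg_right hmass hc0
  have htot : κ ^ 2 * (B : ℝ) + 2 * (κ * B * (κ * ((B : ℝ) / h))) = κ ^ 2 * B * (1 + 2 * (B : ℝ) / h) := by
    field_simp
  linarith

end OneVariable

end Summit.Parity.GeneralizedHardyLittlewood.Theorems.BeyondDiagonalBeatsQuarter.OffDiag
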